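import Literature.MathematicalPhysics.QuantumFieldTheory.Balaban1983to89.B8ExpMeanLogCrossTermPertRec
import Literature.MathematicalPhysics.QuantumFieldTheory.Balaban1983to89.B8BlockConstantLiftStabilityRec

/-!
# `Balaban1983to89.B8ExpMeanLogCrossTermTowerRec` — [Balaban1985Averaging] (79)–(80): THE TOWER FORM of the cross-term bound — the `j`-fold record average `R̄₀ʲ` (centred
# blocking `zdBlockingZ`, trivial background) of a product `a·u` differs from the product of the averages by an ADDITIVELY ACCUMULATED second-order defect:
# `‖R̄₀ⁱ(a·u)(z) − R̄₀ⁱa(z)·R̄₀ⁱu(z)‖ ≤ E_i`, `E₀ = 0`, `E_{i+1} = E_i + 128(p_i + q_i + E_i)²` — item (B′-5)′ of director-ym №312a's envelope, last piece (pen dag-n05-e g41)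

statement-level skeleton of published theorems with citation tags; proofs where landed; nothing here is a claim about the Yang–Mills mass gap

CITATION HEADER (lean-in-tree rule).  Cell `pub-ymgap` (HUMAN RULING D-0062), «N05-REC» road; (B′-5)′ one-step ✓p745467, perturbed one-step (INTENT-14) — THIS FILE sums it along
`Rbar_succ`.  [3] = [Balaban1985Averaging] (78)–(80) p. 30; [15] = [Balaban1985Variational] (100) p. 47; [I] = [Balaban1987RG1] (0.3) p. 252.  `--kind proof --supports
stmt-QuantumFields-20541` (K0⁷; count-neutral; no definition).  REUSED BY NAME: `B8ExpMeanLogCrossTermPertRec.norm_avgStep_sub_mul_le_of_near`, `B7Eq78Linearization.{Rbar, Rbar_zero,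
Rbar_succ}`, `B7SectEFLinearisationRec.{zdBlockingZ, bgTZ, blockSitesZ, mem_blockSitesZ}`, `BlockAveragingZd.{offZ, offZ_apply}`, `B8Eq178AveragesRec.{rbar_bgTZ_eq_uavgZ, smul_mem_blockSitesZ}`,
`B7SectCDGaugeAveragesRec.uavgZ`, `B8Eq119TwistedAxialRec.{UnderZ, underZ_zero_iff, underZ_one_block, underZ_succ_of_underZ_block, bgTZ_one}`.

WHAT IS PROVED (sorry-free).  §1 `card_blockSitesZ` (`|B(y)| = Lᵈ`, `1 ≤ L`), `sum_weights_blockSitesZ` (`Σ L⁻ᵈ = 1`); §2 ★★★ `rbar_one_mul_sub_mul_le_tower` — for `U1`-bounded towers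
of averages (`‖R̄₀ⁱa‖, ‖(R̄₀ⁱa)⁻¹‖, ‖R̄₀ⁱu‖, ‖(R̄₀ⁱu)⁻¹‖, ‖(R̄₀ⁱ(a·u))⁻¹‖ ≤ 1`), per-level oscillations `p_i`, `q_i` of `R̄₀ⁱa`, `R̄₀ⁱu` inside the `(i+1)`-blocks under the cell `y`,
and a defect schedule `E` with `E₀ = 0`, `E_i + 128(p_i + q_i + E_i)² ≤ E_{i+1}`, `p_i + q_i + E_i ≤ 1∕16` (`i < j`): `‖R̄₀ⁱ(a·u)(z) − R̄₀ⁱa(z)·R̄₀ⁱu(z)‖ ≤ E_i` for every `i ≤ j` and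
every `z` under `y` at depth `j − i`; in particular at `z = y`, `i = j`.
HONEST SCOPE.  Bookkeeping of the landed one-step estimate along the record tower; NO printed clause; the choice of `p_i`, `q_i` (sym∕radial twist of `g_sr·X⁻¹`, Theorem 4's `λ₀`) and
the resulting `ψ₂ = E_j = O((θ_j + κε_j)²)` are the junction's; `HThm4Rec*` CONDITIONAL; N05 DISCHARGED OF RECORD since R467 (count-neutral record-level work), N07 NOT discharged;
counts unmoved (typed 28∕28 · discharged 8∕28); one finite 𝕋⁴ programme at fixed ε, `G = SU(2)` of record — nothing continuum ∕ ℝ⁴ ∕ OS ∕ mass gap ∕ Clay.  No `def`, no `instance`,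
no `notation`, no `sorry`.
-/

set_option autoImplicit false

noncomputable section

open scoped BigOperators

namespace Literature.MathematicalPhysics.QuantumFieldTheory.Balaban1983to89.B8ExpMeanLogCrossTermTowerRec

open B7Prop1Explicit hiding Site
open B7Prop1Explicit renaming Site → SiteZ
open B7Eq78Linearization (Rbar Rbar_zero Rbar_succ avgStep)
open B7SectEFLinearisationRec (zdBlockingZ bgTZ blockSitesZ mem_blockSitesZ)
open BlockAveragingZd (offZ offZ_apply)
open B8Eq178AveragesRec (rbar_bgTZ_eq_uavgZ smul_mem_blockSitesZ)
open B7SectCDGaugeAveragesRec (uavgZ)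
open B8Eq119TwistedAxialRec (UnderZ underZ_zero_iff underZ_one_block underZ_succ_of_underZ_block bgTZ_one)
open B8ExpMeanLogCrossTermPertRec (norm_avgStep_sub_mul_le_of_near)
open B8BlockConstantLiftStabilityRec (underZ_add)

variable {d : ℕ}

/-! ## §1  The centred block has `Lᵈ` sites; the (78) weights sum to one -/

/-- `r ↦ L·y + offZ L r` is injective. [cite: Balaban1987RG1, (0.3) p.252 (bookkeeping)] -/
theorem offZ_add_injective (L : ℕ) (y : SiteZ d) : Function.Injective fun r : Fin d → Fin L => (L : ℤ) • y + offZ L r := by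
  intro r r' h
  funext ν
  have h1 := congrFun h ν
  simp only [Pi.add_apply, offZ_apply, add_right_inj, sub_left_inj, Nat.cast_inj] at h1
  exact Fin.ext h1

/-- `|B(y)| = Lᵈ`. [cite: Balaban1987RG1, (0.3) p.252 (bookkeeping)] -/
theorem card_blockSitesZ (L : ℕ) (y : SiteZ d) : (blockSitesZ L y).card = L ^ d := by
  unfold blockSitesZ
  rw [Finset.card_image_of_injective _ (offZ_add_injective L y), Finset.card_univ, Fintype.card_fun, Fintype.card_fin, Fintype.card_fin]

/-- The (78) weights `L⁻ᵈ` over the centred block sum to one (`1 ≤ L`). [cite: Balaban1985Averaging, (78) p.30] -/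
theorem sum_weights_blockSitesZ {L : ℕ} (hL : 1 ≤ L) (y : SiteZ d) : ∑ _x ∈ blockSitesZ L y, ((L : ℝ) ^ d)⁻¹ = 1 := by
  rw [Finset.sum_const, card_blockSitesZ, nsmul_eq_mul, Nat.cast_pow]
  have : (0 : ℝ) < (L : ℝ) ^ d := by positivity
  field_simp

/-! ## §2  The tower form -/

variable {𝔸 : Type*} [NormedRing 𝔸] [NormOneClass 𝔸] [NormedAlgebra ℂ 𝔸] [CompleteSpace 𝔸]

omit [NormOneClass 𝔸] [NormedAlgebra ℂ 𝔸] [CompleteSpace 𝔸] in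
/-- `‖x⁻¹w − 1‖ ≤ E` from `‖w − x‖ ≤ E` and `‖x⁻¹‖ ≤ 1`. [folklore] -/
private theorem norm_inv_mul_sub_one_le {x w : 𝔸ˣ} {E : ℝ} (hx : ‖((x⁻¹ : 𝔸ˣ) : 𝔸)‖ ≤ 1) (h : ‖(w : 𝔸) - (x : 𝔸)‖ ≤ E) :
    ‖((x⁻¹ : 𝔸ˣ) : 𝔸) * (w : 𝔸) - 1‖ ≤ E := by
  have hE : 0 ≤ E := (norm_nonneg _).trans h
  have hrew : ((x⁻¹ : 𝔸ˣ) : 𝔸) * (w : 𝔸) - 1 = ((x⁻¹ : 𝔸ˣ) : 𝔸) * ((w : 𝔸) - (x : 𝔸)) := by rw [mul_sub, Units.inv_mul]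
  rw [hrew]
  calc ‖((x⁻¹ : 𝔸ˣ) : 𝔸) * ((w : 𝔸) - (x : 𝔸))‖ ≤ ‖((x⁻¹ : 𝔸ˣ) : 𝔸)‖ * ‖(w : 𝔸) - (x : 𝔸)‖ := norm_mul_le _ _
    _ ≤ 1 * E := by gcongr
    _ = E := one_mul E

/-- ★★★ **THE CROSS-TERM BOUND, TOWER FORM** ([3] (79)–(80), centred record blocking, trivial background; odd `L`).  Let `a, u` be site fields whose record averages `R̄₀ⁱa = uavgZ L 1 a i`,
`R̄₀ⁱu`, `R̄₀ⁱ(a·u)` are `U1`-bounded, with per-level oscillations `‖(R̄₀ⁱa(L·z))⁻¹R̄₀ⁱa(x) − 1‖ ≤ p_i`, `‖(R̄₀ⁱu(L·z))⁻¹R̄₀ⁱu(x) − 1‖ ≤ q_i` on the block of every `z` under the cell `y` at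
depth `j − (i+1)`, and a schedule `E` with `E₀ = 0`, `E_i + 128(p_i + q_i + E_i)² ≤ E_{i+1}`, `p_i + q_i + E_i ≤ 1∕16` (`i < j`).  Then for every `i ≤ j` and every `z` under `y` at depth
`j − i`: `‖R̄₀ⁱ(a·u)(z) − R̄₀ⁱa(z)·R̄₀ⁱu(z)‖ ≤ E_i` — the one-step defects ADD.  (Road (B′): `a = g_sr·X⁻¹` with `R̄₀^{j}a(y) = 1` exactly, `u = u₀` with `R̄₀^{j}u₀(y) = 1`: row 9′ holds up to
`ψ₂ = E_j`.) [cite: Balaban1985Averaging, (78)–(80) p.30; Balaban1985Variational, (100) p.47; Balaban1987RG1, (0.3) p.252] -/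
theorem rbar_one_mul_sub_mul_le_tower {L : ℕ} (hL : Odd L) (a u : SiteZ d → 𝔸ˣ) (j : ℕ) (y : SiteZ d) (p q E : ℕ → ℝ)
    (hp0 : ∀ i, 0 ≤ p i) (hq0 : ∀ i, 0 ≤ q i) (hE0 : E 0 = 0) (hEn : ∀ i, 0 ≤ E i)
    (hE : ∀ i, i < j → E i + 128 * (p i + q i + E i) ^ 2 ≤ E (i + 1)) (hsm : ∀ i, i < j → p i + q i + E i ≤ 1 / 16)
    -- `U1` bounds on the three towers of averages
    (ha1 : ∀ i x, ‖((uavgZ L (1 : SiteZ d → Fin d → 𝔸ˣ) a i x : 𝔸ˣ) : 𝔸)‖ ≤ 1)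
    (hu1 : ∀ i x, ‖((uavgZ L (1 : SiteZ d → Fin d → 𝔸ˣ) u i x : 𝔸ˣ) : 𝔸)‖ ≤ 1)
    (hu1' : ∀ i x, ‖(((uavgZ L (1 : SiteZ d → Fin d → 𝔸ˣ) u i x)⁻¹ : 𝔸ˣ) : 𝔸)‖ ≤ 1)
    (hw1' : ∀ i x, ‖(((uavgZ L (1 : SiteZ d → Fin d → 𝔸ˣ) (a * u) i x)⁻¹ : 𝔸ˣ) : 𝔸)‖ ≤ 1)
    (ha1' : ∀ i x, ‖(((uavgZ L (1 : SiteZ d → Fin d → 𝔸ˣ) a i x)⁻¹ : 𝔸ˣ) : 𝔸)‖ ≤ 1)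
    -- per-level oscillations inside the blocks under `y`
    (hp : ∀ i, i < j → ∀ z, UnderZ L (j - (i + 1)) y z → ∀ x ∈ blockSitesZ L z,
      ‖(((uavgZ L (1 : SiteZ d → Fin d → 𝔸ˣ) a i ((L : ℤ) • z))⁻¹ : 𝔸ˣ) : 𝔸) * ((uavgZ L (1 : SiteZ d → Fin d → 𝔸ˣ) a i x : 𝔸ˣ) : 𝔸) - 1‖ ≤ p i)
    (hq : ∀ i, i < j → ∀ z, UnderZ L (j - (i + 1)) y z → ∀ x ∈ blockSitesZ L z,
      ‖(((uavgZ L (1 : SiteZ d → Fin d → 𝔸ˣ) u i ((L : ℤ) • z))⁻¹ : 𝔸ˣ) : 𝔸) * ((uavgZ L (1 : SiteZ d → Fin d → 𝔸ˣ) u i x : 𝔸ˣ) : 𝔸) - 1‖ ≤ q i) :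
    ∀ i, i ≤ j → ∀ z, UnderZ L (j - i) y z →
      ‖Rbar (zdBlockingZ d L) (bgTZ L (1 : SiteZ d → Fin d → 𝔸ˣ)) i (fun x => (((a * u) x : 𝔸ˣ) : 𝔸)) z -
        Rbar (zdBlockingZ d L) (bgTZ L (1 : SiteZ d → Fin d → 𝔸ˣ)) i (fun x => ((a x : 𝔸ˣ) : 𝔸)) z *
          Rbar (zdBlockingZ d L) (bgTZ L (1 : SiteZ d → Fin d → 𝔸ˣ)) i (fun x => ((u x : 𝔸ˣ) : 𝔸)) z‖ ≤ E i := by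
  obtain ⟨s, hs⟩ := hL
  have hLs : L = 2 * s + 1 := hs
  have hL1 : 1 ≤ L := by omega
  intro i
  induction i with
  | zero =>
    intro _ z _
    rw [Rbar_zero, Rbar_zero, Rbar_zero, Pi.mul_apply, Units.val_mul, sub_self, norm_zero, hE0]
  | succ i IH =>
    intro hi z hz
    have hij : i < j := by omega
    -- every block site of `z` is under `y` at depth `j − i`
    have hunder : ∀ x ∈ blockSitesZ L z, UnderZ L (j - i) y x := by
      intro x hx
      obtain ⟨r, rfl⟩ := mem_blockSitesZ.1 hx
      have := underZ_add ⟨s, hs⟩ hz (underZ_one_block hLs z r)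
      rwa [show j - (i + 1) + 1 = j - i by omega] at this
    have IH' : ∀ x ∈ blockSitesZ L z,
        ‖Rbar (zdBlockingZ d L) (bgTZ L (1 : SiteZ d → Fin d → 𝔸ˣ)) i (fun x => (((a * u) x : 𝔸ˣ) : 𝔸)) x -
          Rbar (zdBlockingZ d L) (bgTZ L (1 : SiteZ d → Fin d → 𝔸ˣ)) i (fun x => ((a x : 𝔸ˣ) : 𝔸)) x *
            Rbar (zdBlockingZ d L) (bgTZ L (1 : SiteZ d → Fin d → 𝔸ˣ)) i (fun x => ((u x : 𝔸ˣ) : 𝔸)) x‖ ≤ E i :=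
      fun x hx => IH hij.le x (hunder x hx)
    -- the three averages as unit-valued towers
    have hRa := rbar_bgTZ_eq_uavgZ L (1 : SiteZ d → Fin d → 𝔸ˣ) a i
    have hRu := rbar_bgTZ_eq_uavgZ L (1 : SiteZ d → Fin d → 𝔸ˣ) u i
    have hRw := rbar_bgTZ_eq_uavgZ L (1 : SiteZ d → Fin d → 𝔸ˣ) (a * u) i
    rw [Rbar_succ, Rbar_succ, Rbar_succ]
    show ‖avgStep (blockSitesZ L z) (fun _ => ((L : ℝ) ^ d)⁻¹) (bgTZ L (1 : SiteZ d → Fin d → 𝔸ˣ) i z)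
          (Rbar (zdBlockingZ d L) (bgTZ L (1 : SiteZ d → Fin d → 𝔸ˣ)) i (fun x => (((a * u) x : 𝔸ˣ) : 𝔸)) ((L : ℤ) • z))
          (Rbar (zdBlockingZ d L) (bgTZ L (1 : SiteZ d → Fin d → 𝔸ˣ)) i (fun x => (((a * u) x : 𝔸ˣ) : 𝔸))) -
        avgStep (blockSitesZ L z) (fun _ => ((L : ℝ) ^ d)⁻¹) (bgTZ L (1 : SiteZ d → Fin d → 𝔸ˣ) i z)
          (Rbar (zdBlockingZ d L) (bgTZ L (1 : SiteZ d → Fin d → 𝔸ˣ)) i (fun x => ((a x : 𝔸ˣ) : 𝔸)) ((L : ℤ) • z))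
          (Rbar (zdBlockingZ d L) (bgTZ L (1 : SiteZ d → Fin d → 𝔸ˣ)) i (fun x => ((a x : 𝔸ˣ) : 𝔸))) *
        avgStep (blockSitesZ L z) (fun _ => ((L : ℝ) ^ d)⁻¹) (bgTZ L (1 : SiteZ d → Fin d → 𝔸ˣ) i z)
          (Rbar (zdBlockingZ d L) (bgTZ L (1 : SiteZ d → Fin d → 𝔸ˣ)) i (fun x => ((u x : 𝔸ˣ) : 𝔸)) ((L : ℤ) • z))
          (Rbar (zdBlockingZ d L) (bgTZ L (1 : SiteZ d → Fin d → 𝔸ˣ)) i (fun x => ((u x : 𝔸ˣ) : 𝔸)))‖ ≤ E (i + 1)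
    -- base values are the units `uavgZ … (L·z)`
    have hbw : Rbar (zdBlockingZ d L) (bgTZ L (1 : SiteZ d → Fin d → 𝔸ˣ)) i (fun x => (((a * u) x : 𝔸ˣ) : 𝔸)) ((L : ℤ) • z) =
        ((uavgZ L (1 : SiteZ d → Fin d → 𝔸ˣ) (a * u) i ((L : ℤ) • z) : 𝔸ˣ) : 𝔸) := by rw [hRw]
    have hba : Rbar (zdBlockingZ d L) (bgTZ L (1 : SiteZ d → Fin d → 𝔸ˣ)) i (fun x => ((a x : 𝔸ˣ) : 𝔸)) ((L : ℤ) • z) =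
        ((uavgZ L (1 : SiteZ d → Fin d → 𝔸ˣ) a i ((L : ℤ) • z) : 𝔸ˣ) : 𝔸) := by rw [hRa]
    have hbu : Rbar (zdBlockingZ d L) (bgTZ L (1 : SiteZ d → Fin d → 𝔸ˣ)) i (fun x => ((u x : 𝔸ˣ) : 𝔸)) ((L : ℤ) • z) =
        ((uavgZ L (1 : SiteZ d → Fin d → 𝔸ˣ) u i ((L : ℤ) • z) : 𝔸ˣ) : 𝔸) := by rw [hRu]
    rw [hbw, hba, hbu]
    -- the centre is a block site, so the induction hypothesis controls the base perturbation
    have hctr := IH' _ (smul_mem_blockSitesZ hL1 z)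
    rw [hRw, hRa, hRu] at hctr
    simp only [← Units.val_mul] at hctr
    have hctr' : ‖((uavgZ L (1 : SiteZ d → Fin d → 𝔸ˣ) a i ((L : ℤ) • z) * uavgZ L (1 : SiteZ d → Fin d → 𝔸ˣ) u i ((L : ℤ) • z) : 𝔸ˣ) : 𝔸) -
        ((uavgZ L (1 : SiteZ d → Fin d → 𝔸ˣ) (a * u) i ((L : ℤ) • z) : 𝔸ˣ) : 𝔸)‖ ≤ E i := by rw [norm_sub_rev]; exact hctr
    have hinv : ‖(((uavgZ L (1 : SiteZ d → Fin d → 𝔸ˣ) a i ((L : ℤ) • z) * uavgZ L (1 : SiteZ d → Fin d → 𝔸ˣ) u i ((L : ℤ) • z))⁻¹ : 𝔸ˣ) : 𝔸)‖ ≤ 1 := by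
      rw [mul_inv_rev, Units.val_mul]
      calc _ ≤ ‖(((uavgZ L (1 : SiteZ d → Fin d → 𝔸ˣ) u i ((L : ℤ) • z))⁻¹ : 𝔸ˣ) : 𝔸)‖ * ‖(((uavgZ L (1 : SiteZ d → Fin d → 𝔸ˣ) a i ((L : ℤ) • z))⁻¹ : 𝔸ˣ) : 𝔸)‖ :=
            norm_mul_le _ _
        _ ≤ 1 * 1 := by gcongr <;> first | exact hu1' i _ | exact ha1' i _
        _ = 1 := one_mul 1
    have hsm_i := hsm i hij
    exact (norm_avgStep_sub_mul_le_of_near (blockSitesZ L z) (fun _ _ => by positivity) (sum_weights_blockSitesZ hL1 z)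
      (fun x _ => by rw [bgTZ_one]) _ _ _ (ha1 i _) (hu1 i _) (hu1' i _) (hw1' i _) _ _ _ (hp0 i) (hq0 i) (hEn i) hsm_i
      (fun x hx => by rw [hRa]; exact hp i hij z hz x hx) (fun x hx => by rw [hRu]; exact hq i hij z hz x hx)
      (norm_inv_mul_sub_one_le hinv hctr) (norm_inv_mul_sub_one_le (hw1' i _) hctr') IH').trans (hE i hij)

end Literature.MathematicalPhysics.QuantumFieldTheory.Balaban1983to89.B8ExpMeanLogCrossTermTowerRec
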